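import Summits.AtomisticToContinuum.BoseEinsteinCondensation.Theorems.BECThomsonPrincipleGDTransferSeededIntegrableDefs
import Literature.MathematicalPhysics.QuantumManyBody.JelliumBoseGasDilation

/-!
# Route `BECThomsonPrinciple`, crux `GDTransfer` (stmt-AtomisticToContinuum-9482), line `seeded-continuity`
# (skeleton v7): stub `stub_dilationL32` — `L^{3/2}(ℝ³)`-continuity of dilations, as a two-sided sandwich

For a measurable radial profile `u`, finite on `[0, ∞)`, of finite range `R₀`, whose lift `x ↦ u(|x|)` has
`∫_{ℝ³} u(|x|)^{3/2} dx < ∞`, and `η > 0`, we produce `ϑ > 0` such that for every `b` with `|b − 1| < ϑ` the error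
profile `w := |b⁻²u(·/b) − u|` (real absolute difference of the `toReal` values, re-embedded into `ℝ≥0∞`) is
measurable, vanishes beyond `2·max R₀ 0`, has `∫_{ℝ³} w(|x|)^{3/2} dx ≤ η`, and sandwiches the scaled profile
`scaledPotential u b = b⁻²u(·/b)` against `u` both ways on `ℝ³` (`DilationL32`, statement (E') of the integrable
transport device of `BECThomsonPrincipleGDTransferSeededIntegrableDefs.lean`; the `L¹` / bounded version is the landed
`stub_dilationL1`).

The analytic content is the continuity of dilations in `L^{3/2}(ℝ³)` (`dil32_lintegral_rpow_dilate_sub_le`): for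
`F ∈ L^{3/2}(ℝ³)`, `∫ |b⁻²F(x/b) − F(x)|^{3/2} dx → 0` as `b → 1`.  Proof: approximate `F` in `L^{3/2}` by a
continuous compactly supported `g` (`MeasureTheory.MemLp.exists_hasCompactSupport_eLpNorm_sub_le`); in three
dimensions the dilation `h ↦ b⁻²h(·/b)` is an ISOMETRY of `L^{3/2}` (`dil32_lintegral_rpow_dilate`: Jacobian `b³`
against `(b⁻²)^{3/2} = b⁻³`, change of variables `lintegral_comp_smul_addHaar` of the tree), so the dilate of `F − g`
costs exactly `‖F − g‖_{3/2}`; the middle term `∫ |b⁻²g(x/b) − g(x)|^{3/2} → 0` is reduced by the interpolation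
`|h|^{3/2} ≤ M^{1/2}|h|` (`|h| ≤ M` on `|b − 1| < 1/2`) to the landed `L¹` statement
`dil_continuousAt_integral_dilate_sub`; the three pieces are assembled with the power-mean inequality
`(c + m + a)^{3/2} ≤ 2c^{3/2} + 4m^{3/2} + 4a^{3/2}` (`ENNReal.rpow_add_le_mul_rpow_add_rpow`) instead of Minkowski.

References: LSSY2005 Ch. 5, footnote to (5.3) (scaling of the torus problem); LiebLoss2001 Thm 2.16 (density of
`C_c` in `L^p`) — background only; everything here is proved from Mathlib and the landed `…SeededDilationL1`.
-/

noncomputable section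

open MeasureTheory Filter Set Metric
open scoped ENNReal NNReal Topology

namespace Summit.AtomisticToContinuum.BoseEinsteinCondensation.Cruxes.GDTransfer.Seeded

open Literature.MathematicalPhysics.QuantumManyBody.BoseGas
open Literature.Barriers.AtomisticToContinuum.BoseGas (scaledPotential)

/-! ## §1 Continuity of dilations in `L^{3/2}(ℝ³)` -/

/-- **The dilation `h ↦ b⁻²h(·/b)` is an isometry of `L^{3/2}(ℝ³)`** (`b > 0`):
`∫ |b⁻² h(x/b)|^{3/2} dx = ∫ |h(x)|^{3/2} dx` — the Jacobian `b³` of `x ↦ x/b` (the tree's change of variables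
`lintegral_comp_smul_addHaar`) cancels `(b⁻²)^{3/2} = b⁻³`. [folklore] -/
theorem dil32_lintegral_rpow_dilate (h : Space → ℝ) {b : ℝ} (hb : 0 < b) :
    ∫⁻ x : Space, ‖(b ^ 2)⁻¹ * h (b⁻¹ • x)‖ₑ ^ ((3 : ℝ) / 2) =
      ∫⁻ x : Space, ‖h x‖ₑ ^ ((3 : ℝ) / 2) := by
  have h3 : Module.finrank ℝ Space = 3 := finrank_euclideanSpace_fin
  have hc : ‖(b ^ 2)⁻¹‖ₑ ^ ((3 : ℝ) / 2) * ENNReal.ofReal |((b⁻¹) ^ 3)⁻¹| = 1 := by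
    rw [Real.enorm_eq_ofReal (by positivity), ENNReal.ofReal_rpow_of_nonneg (by positivity) (by norm_num),
      ← ENNReal.ofReal_mul (by positivity), ← ENNReal.ofReal_one]
    congr 1
    rw [inv_pow, inv_inv, abs_of_pos (by positivity), show (b ^ 2 : ℝ) = b ^ (2 : ℝ) by norm_cast,
      Real.inv_rpow (by positivity), ← Real.rpow_mul hb.le]
    norm_num
    field_simp
  simp only [enorm_mul, ENNReal.mul_rpow_of_nonneg _ _ (by norm_num : (0 : ℝ) ≤ 3 / 2)]
  rw [lintegral_const_mul' _ _ (ENNReal.rpow_ne_top_of_nonneg (by norm_num) enorm_ne_top),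
    lintegral_comp_smul_addHaar volume (fun x : Space => ‖h x‖ₑ ^ ((3 : ℝ) / 2)) (inv_ne_zero hb.ne'), h3,
    ← mul_assoc, hc, one_mul]

/-- Power mean with exponent `3/2`: `(x + y)^{3/2} ≤ 2 (x^{3/2} + y^{3/2})` in `ℝ≥0∞` (`2^{1/2} ≤ 2`). [folklore] -/
theorem dil32_rpow_add_le (x y : ℝ≥0∞) :
    (x + y) ^ ((3 : ℝ) / 2) ≤ 2 * (x ^ ((3 : ℝ) / 2) + y ^ ((3 : ℝ) / 2)) :=
  calc (x + y) ^ ((3 : ℝ) / 2) ≤ (2 : ℝ≥0∞) ^ ((3 : ℝ) / 2 - 1) * (x ^ ((3 : ℝ) / 2) + y ^ ((3 : ℝ) / 2)) :=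
      ENNReal.rpow_add_le_mul_rpow_add_rpow x y (by norm_num)
    _ ≤ 2 * (x ^ ((3 : ℝ) / 2) + y ^ ((3 : ℝ) / 2)) := by
      gcongr
      calc (2 : ℝ≥0∞) ^ ((3 : ℝ) / 2 - 1) ≤ (2 : ℝ≥0∞) ^ (1 : ℝ) :=
            ENNReal.rpow_le_rpow_of_exponent_le (by norm_num) (by norm_num)
        _ = 2 := ENNReal.rpow_one 2

/-- **The middle term.**  For a continuous compactly supported `g : ℝ³ → ℝ`,
`∫ |b⁻² g(x/b) − g(x)|^{3/2} dx → 0` as `b → 1`: for `|b − 1| < 1/2` the integrand is `≤ M^{1/2} |b⁻² g(x/b) − g(x)|`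
with `M = 5 sup|g|`, and `∫ |b⁻² g(x/b) − g(x)| dx → 0` is the landed `L¹` statement
`dil_continuousAt_integral_dilate_sub`. [folklore] -/
theorem dil32_tendsto_lintegral_rpow_dilate_sub {g : Space → ℝ} (hg : Continuous g) (hgs : HasCompactSupport g) :
    Tendsto (fun b : ℝ => ∫⁻ x : Space, ‖(b ^ 2)⁻¹ * g (b⁻¹ • x) - g x‖ₑ ^ ((3 : ℝ) / 2)) (𝓝 1) (𝓝 0) := by
  obtain ⟨C, hC⟩ := hg.bounded_above_of_compact_support hgs
  have hgi : Integrable g := hg.integrable_of_hasCompactSupport hgs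
  set M : ℝ≥0∞ := ENNReal.ofReal (4 * C + C) ^ ((1 : ℝ) / 2) with hM
  have hMtop : M ≠ ⊤ := ENNReal.rpow_ne_top_of_nonneg (by norm_num) ENNReal.ofReal_ne_top
  -- the `L¹` statement, moved to `ℝ≥0∞` and multiplied by `M`
  have h1 : Tendsto (fun b : ℝ => M * ENNReal.ofReal (∫ x : Space, |(b ^ 2)⁻¹ * g (b⁻¹ • x) - g x|))
      (𝓝 1) (𝓝 0) := by
    have h := (dil_continuousAt_integral_dilate_sub hg hgs).tendsto
    simp only [one_pow, inv_one, one_smul, one_mul, sub_self, abs_zero, integral_zero] at h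
    have h' := ENNReal.Tendsto.const_mul (a := M) (ENNReal.tendsto_ofReal h) (Or.inr hMtop)
    rwa [ENNReal.ofReal_zero, mul_zero] at h'
  -- squeeze, with the domination valid for `|b - 1| < 1/2`
  have hball : ∀ᶠ b : ℝ in 𝓝 1, |b - 1| < 1 / 2 := by
    have h : ball (1 : ℝ) (1 / 2) ∈ 𝓝 (1 : ℝ) := ball_mem_nhds _ (by norm_num)
    filter_upwards [h] with b hb
    rwa [mem_ball, Real.dist_eq] at hb
  refine tendsto_of_tendsto_of_tendsto_of_le_of_le' tendsto_const_nhds h1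
    (Eventually.of_forall fun _ => zero_le) ?_
  filter_upwards [hball] with b hb
  have hb1 : 1 / 2 < b := by linarith [(abs_lt.1 hb).1]
  have hb2 : b < 3 / 2 := by linarith [(abs_lt.1 hb).2]
  have hb0 : 0 < b := by linarith
  have hb4 : (b ^ 2)⁻¹ ≤ 4 := by
    rw [inv_le_comm₀ (by positivity) (by norm_num)]
    nlinarith
  -- pointwise domination `|b⁻² g(x/b) − g(x)| ≤ 4C + C`
  have hptw : ∀ x : Space, ‖(b ^ 2)⁻¹ * g (b⁻¹ • x) - g x‖ₑ ≤ ENNReal.ofReal (4 * C + C) := by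
    intro x
    rw [Real.enorm_eq_ofReal_abs]
    refine ENNReal.ofReal_le_ofReal ?_
    have h1 : |(b ^ 2)⁻¹ * g (b⁻¹ • x)| ≤ 4 * C := by
      rw [abs_mul, abs_inv, abs_of_nonneg (sq_nonneg b)]
      have h := hC (b⁻¹ • x)
      rw [Real.norm_eq_abs] at h
      exact mul_le_mul hb4 h (abs_nonneg _) (by norm_num)
    have h2 : |g x| ≤ C := by simpa only [Real.norm_eq_abs] using hC x
    exact (abs_sub _ _).trans (add_le_add h1 h2)
  have hI : Integrable (fun x : Space => (b ^ 2)⁻¹ * g (b⁻¹ • x) - g x) :=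
    (((hgi.comp_smul (inv_ne_zero hb0.ne')).const_mul _).sub hgi)
  calc ∫⁻ x : Space, ‖(b ^ 2)⁻¹ * g (b⁻¹ • x) - g x‖ₑ ^ ((3 : ℝ) / 2)
      ≤ ∫⁻ x : Space, M * ‖(b ^ 2)⁻¹ * g (b⁻¹ • x) - g x‖ₑ := by
        refine lintegral_mono fun x => ?_
        rw [show ((3 : ℝ) / 2) = 1 / 2 + 1 by norm_num,
          ENNReal.rpow_add_of_nonneg _ _ (by norm_num) (by norm_num), ENNReal.rpow_one]
        exact mul_le_mul' (ENNReal.rpow_le_rpow (hptw x) (by norm_num)) le_rfl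
    _ = M * ENNReal.ofReal (∫ x : Space, |(b ^ 2)⁻¹ * g (b⁻¹ • x) - g x|) := by
        rw [lintegral_const_mul' _ _ hMtop, ← ofReal_integral_norm_eq_lintegral_enorm hI]
        simp only [Real.norm_eq_abs]

/-- **Continuity of dilations in `L^{3/2}(ℝ³)`.**  For `F ∈ L^{3/2}(ℝ³)` and `ε > 0` there is `ϑ > 0` such that
`∫ |b⁻² F(x/b) − F(x)|^{3/2} dx ≤ ε` whenever `|b − 1| < ϑ`: approximate `F` in `L^{3/2}` by a continuous compactly
supported `g` (`MemLp.exists_hasCompactSupport_eLpNorm_sub_le`); the dilate of `F − g` costs exactly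
`∫ |F − g|^{3/2}` (`dil32_lintegral_rpow_dilate`), the middle term is `dil32_tendsto_lintegral_rpow_dilate_sub`, and
pointwise `(c + m + a)^{3/2} ≤ 2c^{3/2} + 4m^{3/2} + 4a^{3/2}` (`dil32_rpow_add_le`). [folklore] -/
theorem dil32_lintegral_rpow_dilate_sub_le {F : Space → ℝ} (hF : MemLp F ((3 : ℝ≥0∞) / 2)) {ε : ℝ≥0∞}
    (hε : ε ≠ 0) :
    ∃ ϑ : ℝ, 0 < ϑ ∧ ∀ b : ℝ, |b - 1| < ϑ →
      ∫⁻ x : Space, ‖(b ^ 2)⁻¹ * F (b⁻¹ • x) - F x‖ₑ ^ ((3 : ℝ) / 2) ≤ ε := by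
  have hp0 : ((3 : ℝ≥0∞) / 2) ≠ 0 := by simp
  have hptop : ((3 : ℝ≥0∞) / 2) ≠ ⊤ := by simp [ENNReal.div_eq_top]
  have hpr : ((3 : ℝ≥0∞) / 2).toReal = 3 / 2 := by simp
  -- every piece will be `≤ ε' = ε / 10`
  set ε' : ℝ≥0∞ := ε / 10 with hε'
  have hε'0 : ε' ≠ 0 := (ENNReal.div_pos hε (by simp)).ne'
  -- density of `C_c` in `L^{3/2}`: `g` with `∫ |F − g|^{3/2} ≤ ε'`
  obtain ⟨g, hgs, hFg, hg, -⟩ := hF.exists_hasCompactSupport_eLpNorm_sub_le hptop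
    (ENNReal.rpow_pos_of_nonneg (pos_iff_ne_zero.2 hε'0) (by norm_num : (0 : ℝ) ≤ 2 / 3)).ne'
  have hFg' : ∫⁻ x : Space, ‖F x - g x‖ₑ ^ ((3 : ℝ) / 2) ≤ ε' := by
    have h := ENNReal.rpow_le_rpow (z := (3 : ℝ) / 2) hFg (by norm_num)
    rw [eLpNorm_eq_lintegral_rpow_enorm_toReal hp0 hptop, hpr, ← ENNReal.rpow_mul, ← ENNReal.rpow_mul] at h
    norm_num at h
    simpa only [Pi.sub_apply] using h
  -- the middle term is eventually `< ε'`; also keep `|b - 1| < 1/2`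
  have hmid : ∀ᶠ b : ℝ in 𝓝 1, ∫⁻ x : Space, ‖(b ^ 2)⁻¹ * g (b⁻¹ • x) - g x‖ₑ ^ ((3 : ℝ) / 2) < ε' :=
    (dil32_tendsto_lintegral_rpow_dilate_sub hg hgs).eventually_lt_const (pos_iff_ne_zero.2 hε'0)
  have hball : ∀ᶠ b : ℝ in 𝓝 1, |b - 1| < 1 / 2 := by
    have h : ball (1 : ℝ) (1 / 2) ∈ 𝓝 (1 : ℝ) := ball_mem_nhds _ (by norm_num)
    filter_upwards [h] with b hb
    rwa [mem_ball, Real.dist_eq] at hb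
  obtain ⟨ϑ, hϑ, hϑ'⟩ := Metric.eventually_nhds_iff.1 (hmid.and hball)
  refine ⟨ϑ, hϑ, fun b hb => ?_⟩
  obtain ⟨hmb, hb'⟩ := hϑ' (show dist b 1 < ϑ by rwa [Real.dist_eq])
  have hmb' := hmb.le
  have hb0 : 0 < b := by linarith [(abs_lt.1 hb').1]
  -- pointwise splitting `F_b − F = −(F − g) + ((g_b − g) + (F − g)_b)` and the power mean
  have hptw : ∀ x : Space, ‖(b ^ 2)⁻¹ * F (b⁻¹ • x) - F x‖ₑ ^ ((3 : ℝ) / 2) ≤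
      2 * ‖F x - g x‖ₑ ^ ((3 : ℝ) / 2) +
        (4 * ‖(b ^ 2)⁻¹ * g (b⁻¹ • x) - g x‖ₑ ^ ((3 : ℝ) / 2) +
          4 * ‖(b ^ 2)⁻¹ * (F (b⁻¹ • x) - g (b⁻¹ • x))‖ₑ ^ ((3 : ℝ) / 2)) := by
    intro x
    have hsplit : ‖(b ^ 2)⁻¹ * F (b⁻¹ • x) - F x‖ₑ ≤ ‖F x - g x‖ₑ +
        (‖(b ^ 2)⁻¹ * g (b⁻¹ • x) - g x‖ₑ + ‖(b ^ 2)⁻¹ * (F (b⁻¹ • x) - g (b⁻¹ • x))‖ₑ) := by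
      have h : (b ^ 2)⁻¹ * F (b⁻¹ • x) - F x =
          -(F x - g x) + (((b ^ 2)⁻¹ * g (b⁻¹ • x) - g x) + (b ^ 2)⁻¹ * (F (b⁻¹ • x) - g (b⁻¹ • x))) := by
        ring
      rw [h]
      calc ‖-(F x - g x) + (((b ^ 2)⁻¹ * g (b⁻¹ • x) - g x) + (b ^ 2)⁻¹ * (F (b⁻¹ • x) - g (b⁻¹ • x)))‖ₑ
          ≤ ‖-(F x - g x)‖ₑ + ‖((b ^ 2)⁻¹ * g (b⁻¹ • x) - g x) + (b ^ 2)⁻¹ * (F (b⁻¹ • x) - g (b⁻¹ • x))‖ₑ :=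
            enorm_add_le _ _
        _ ≤ _ := add_le_add (enorm_neg _).le (enorm_add_le _ _)
    calc ‖(b ^ 2)⁻¹ * F (b⁻¹ • x) - F x‖ₑ ^ ((3 : ℝ) / 2)
        ≤ (‖F x - g x‖ₑ + (‖(b ^ 2)⁻¹ * g (b⁻¹ • x) - g x‖ₑ +
            ‖(b ^ 2)⁻¹ * (F (b⁻¹ • x) - g (b⁻¹ • x))‖ₑ)) ^ ((3 : ℝ) / 2) :=
          ENNReal.rpow_le_rpow hsplit (by norm_num)
      _ ≤ 2 * (‖F x - g x‖ₑ ^ ((3 : ℝ) / 2) + (‖(b ^ 2)⁻¹ * g (b⁻¹ • x) - g x‖ₑ +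
            ‖(b ^ 2)⁻¹ * (F (b⁻¹ • x) - g (b⁻¹ • x))‖ₑ) ^ ((3 : ℝ) / 2)) := dil32_rpow_add_le _ _
      _ ≤ 2 * (‖F x - g x‖ₑ ^ ((3 : ℝ) / 2) + 2 * (‖(b ^ 2)⁻¹ * g (b⁻¹ • x) - g x‖ₑ ^ ((3 : ℝ) / 2) +
            ‖(b ^ 2)⁻¹ * (F (b⁻¹ • x) - g (b⁻¹ • x))‖ₑ ^ ((3 : ℝ) / 2))) := by
          gcongr
          exact dil32_rpow_add_le _ _
      _ = _ := by ring
  -- measurability of the first two pieces (enough to split the integral of the sum)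
  have hCm : AEMeasurable (fun x : Space => 2 * ‖F x - g x‖ₑ ^ ((3 : ℝ) / 2)) :=
    ((hF.1.sub hg.aestronglyMeasurable).enorm.pow_const _).const_mul _
  have hMm : Measurable (fun x : Space => 4 * ‖(b ^ 2)⁻¹ * g (b⁻¹ • x) - g x‖ₑ ^ ((3 : ℝ) / 2)) := by
    have h : Continuous fun x : Space => (b ^ 2)⁻¹ * g (b⁻¹ • x) - g x := by fun_prop
    exact (h.measurable.enorm.pow_const _).const_mul _
  have h2 : (2 : ℝ≥0∞) ≠ ⊤ := ENNReal.ofNat_ne_top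
  have h4 : (4 : ℝ≥0∞) ≠ ⊤ := ENNReal.ofNat_ne_top
  calc ∫⁻ x : Space, ‖(b ^ 2)⁻¹ * F (b⁻¹ • x) - F x‖ₑ ^ ((3 : ℝ) / 2)
      ≤ ∫⁻ x : Space, (2 * ‖F x - g x‖ₑ ^ ((3 : ℝ) / 2) +
          (4 * ‖(b ^ 2)⁻¹ * g (b⁻¹ • x) - g x‖ₑ ^ ((3 : ℝ) / 2) +
            4 * ‖(b ^ 2)⁻¹ * (F (b⁻¹ • x) - g (b⁻¹ • x))‖ₑ ^ ((3 : ℝ) / 2))) := lintegral_mono hptw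
    _ = 2 * (∫⁻ x : Space, ‖F x - g x‖ₑ ^ ((3 : ℝ) / 2)) +
          (4 * (∫⁻ x : Space, ‖(b ^ 2)⁻¹ * g (b⁻¹ • x) - g x‖ₑ ^ ((3 : ℝ) / 2)) +
            4 * (∫⁻ x : Space, ‖(b ^ 2)⁻¹ * (F (b⁻¹ • x) - g (b⁻¹ • x))‖ₑ ^ ((3 : ℝ) / 2))) := by
        rw [lintegral_add_left' hCm, lintegral_add_left hMm, lintegral_const_mul' _ _ h2,
          lintegral_const_mul' _ _ h4, lintegral_const_mul' _ _ h4]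
    _ = 2 * (∫⁻ x : Space, ‖F x - g x‖ₑ ^ ((3 : ℝ) / 2)) +
          (4 * (∫⁻ x : Space, ‖(b ^ 2)⁻¹ * g (b⁻¹ • x) - g x‖ₑ ^ ((3 : ℝ) / 2)) +
            4 * (∫⁻ x : Space, ‖F x - g x‖ₑ ^ ((3 : ℝ) / 2))) := by
        rw [dil32_lintegral_rpow_dilate (fun y => F y - g y) hb0]
    _ ≤ 2 * ε' + (4 * ε' + 4 * ε') := by gcongr
    _ = ε := by
        rw [hε']
        calc 2 * (ε / 10) + (4 * (ε / 10) + 4 * (ε / 10)) = 10 * (ε / 10) := by ring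
          _ = ε := ENNReal.mul_div_cancel (by norm_num) (by norm_num)

/-! ## §2 The stub -/

/-- **Stub `stub_dilationL32` (statement (E') `DilationL32`).**  For a measurable profile `u`, finite on `[0, ∞)`,
of range `R₀`, with `∫_{ℝ³} u(|x|)^{3/2} dx < ∞`, and `η > 0`, there is `ϑ > 0` such that for `|b − 1| < ϑ` the
profile `w := |b⁻²u(·/b) − u|` (difference of the real values) is measurable, vanishes beyond `2·max R₀ 0`, has
`∫_{ℝ³} w(|x|)^{3/2} dx ≤ η`, and `b⁻²u(|x|/b) ≤ u(|x|) + w(|x|)`, `u(|x|) ≤ b⁻²u(|x|/b) + w(|x|)` on `ℝ³` (where all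
values are finite).  The `L^{3/2}` bound is `dil32_lintegral_rpow_dilate_sub_le` applied to the lift
`F(x) = u(|x|).toReal ∈ L^{3/2}(ℝ³)`. -/
theorem stub_dilationL32 : Sig.stub_dilationL32 := by
  intro u hu hufin hu32 R₀ hR₀ η hη
  -- the real lift `F` and its membership in `L^{3/2}(ℝ³)`
  set F : Space → ℝ := fun x => (u ‖x‖).toReal with hFdef
  have hFm : Measurable F := (hu.comp measurable_norm).ennreal_toReal
  have hFx : ∀ x : Space, ‖F x‖ₑ = u ‖x‖ := fun x => by
    rw [hFdef]
    dsimp only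
    rw [Real.enorm_eq_ofReal ENNReal.toReal_nonneg, ENNReal.ofReal_toReal (hufin _ (norm_nonneg x))]
  have hp0 : ((3 : ℝ≥0∞) / 2) ≠ 0 := by simp
  have hptop : ((3 : ℝ≥0∞) / 2) ≠ ⊤ := by simp [ENNReal.div_eq_top]
  have hpr : ((3 : ℝ≥0∞) / 2).toReal = 3 / 2 := by simp
  have hF : MemLp F ((3 : ℝ≥0∞) / 2) := by
    refine ⟨hFm.aestronglyMeasurable, (eLpNorm_lt_top_iff_lintegral_rpow_enorm_lt_top hp0 hptop).2 ?_⟩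
    simp only [hpr, hFx]
    exact hu32.lt_top
  obtain ⟨ϑ, hϑ, hclose⟩ := dil32_lintegral_rpow_dilate_sub_le hF (ENNReal.ofReal_pos.2 hη).ne'
  refine ⟨min (1 / 2) ϑ, by positivity, fun b hb => ?_⟩
  have hb' : |b - 1| < 1 / 2 := hb.trans_le (min_le_left _ _)
  have hbϑ : |b - 1| < ϑ := hb.trans_le (min_le_right _ _)
  have hb1 : 1 / 2 < b := by linarith [(abs_lt.1 hb').1]
  have hb2 : b < 3 / 2 := by linarith [(abs_lt.1 hb').2]
  have hb0 : 0 < b := by linarith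
  -- the scaled profile: closed form, finiteness on `[0, ∞)`, real value, measurability
  have hsc : ∀ r, scaledPotential u b r = ENNReal.ofReal (b ^ 2)⁻¹ * u (r / b) := fun r => by
    simp only [scaledPotential]
    rw [ENNReal.ofReal_inv_of_pos (by positivity)]
  have hscfin : ∀ r, 0 ≤ r → scaledPotential u b r ≠ ⊤ := fun r hr => by
    rw [hsc]
    exact ENNReal.mul_ne_top ENNReal.ofReal_ne_top (hufin _ (div_nonneg hr hb0.le))
  have hscR : ∀ r, (scaledPotential u b r).toReal = (b ^ 2)⁻¹ * (u (r / b)).toReal := fun r => by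
    rw [hsc, ENNReal.toReal_mul, ENNReal.toReal_ofReal (inv_nonneg.2 (sq_nonneg b))]
  have hscm : Measurable (scaledPotential u b) := (hu.comp (measurable_id.div_const b)).const_mul _
  -- the error profile `w = |u_b - u|`
  refine ⟨fun r => ENNReal.ofReal |(scaledPotential u b r).toReal - (u r).toReal|, ?_, ?_, ?_, ?_, ?_⟩
  · -- measurable
    exact (continuous_abs.measurable.comp (hscm.ennreal_toReal.sub hu.ennreal_toReal)).ennreal_ofReal
  · -- vanishing beyond `2 · max R₀ 0`
    intro r hr
    have hR : max R₀ 0 ≤ 2 * max R₀ 0 := by linarith [le_max_right R₀ 0]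
    have hur : u r = 0 := hR₀ r ((le_max_left _ _).trans_lt (hR.trans_lt hr))
    have hurb : u (r / b) = 0 := by
      apply hR₀
      rw [lt_div_iff₀ hb0]
      calc R₀ * b ≤ max R₀ 0 * b := mul_le_mul_of_nonneg_right (le_max_left _ _) hb0.le
        _ ≤ max R₀ 0 * 2 := mul_le_mul_of_nonneg_left (by linarith) (le_max_right _ _)
        _ = 2 * max R₀ 0 := by ring
        _ < r := hr
    simp [hsc, hur, hurb]
  · -- the `L^{3/2}(ℝ³)` bound
    have hwx : ∀ x : Space, ENNReal.ofReal |(scaledPotential u b ‖x‖).toReal - (u ‖x‖).toReal| =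
        ‖(b ^ 2)⁻¹ * F (b⁻¹ • x) - F x‖ₑ := fun x => by
      rw [Real.enorm_eq_ofReal_abs]
      simp only [hscR, hFdef, norm_smul, norm_inv, Real.norm_of_nonneg hb0.le, div_eq_inv_mul]
    calc ∫⁻ x : Space, ENNReal.ofReal |(scaledPotential u b ‖x‖).toReal - (u ‖x‖).toReal| ^ ((3 : ℝ) / 2)
        = ∫⁻ x : Space, ‖(b ^ 2)⁻¹ * F (b⁻¹ • x) - F x‖ₑ ^ ((3 : ℝ) / 2) :=
          lintegral_congr fun x => by rw [hwx x]
      _ ≤ ENNReal.ofReal η := hclose b hbϑ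
  · -- `u_b ≤ u + w`
    intro x
    exact dil_le_add_ofReal_abs_sub (hscfin _ (norm_nonneg x)) (hufin _ (norm_nonneg x))
  · -- `u ≤ u_b + w`
    intro x
    exact dil_le_add_ofReal_abs_sub' (hscfin _ (norm_nonneg x)) (hufin _ (norm_nonneg x))

end Summit.AtomisticToContinuum.BoseEinsteinCondensation.Cruxes.GDTransfer.Seeded

end
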